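import Literature.Analysis.Fourier.SmoothWindowKernel
import HarnessLib

/-!
# The dyadic smooth window `w_{T,H}` and the decay of `∫ w_{T,H}(t) A(t) e^{iμt} dt`

Topic `Literature/Analysis/Fourier`. Definitions with bodies and theorems; everything in this file is
PROVED (no named facts).

For mean-value computations over a dyadic interval `[T, 2T]` with a smooth weight one uses the
window `w_{T,H}(t) = f(t/H)`, `f = smoothWindow (T/H) (2T/H − 1)` of `SmoothWindow.lean`:
`w = 1` on `[T + H, 2T − H]`, `w = 0` outside `(T, 2T)`, `0 ≤ w ≤ 1`, `|w^{(j)}| ≤ 2D_j H^{-j}`.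
Against a smooth amplitude `A` with `|A^{(j)}| ≤ B T^{-j}` on `[T, 2T]` (`j ≤ k`) and a frequency
`μ ≠ 0`, `k` integrations by parts (in the form of Mathlib's `Real.fourier_iteratedDeriv`, through
the tree's `Literature.Analysis.Fourier.pow_mul_norm_fourier_le`) give

  `|∫ w_{T,H}(t) A(t) e^{iμt} dt| ≤ C_k · B · T · (H|μ|)^{-k}`     (`1 ≤ H`, `2H ≤ T`),

with `C_k = ∑_{j≤k} (k choose j) W_j`, `W_0 = 1`, `W_j = 2D_j` — a constant depending on `k` only.
This is the standard "non-stationary phase" bound used to discard the off-diagonal terms of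
smoothed mean values of Dirichlet polynomials.

## Main definitions and results (namespace `Literature.Analysis.Fourier`)

* `dyadicWindow T H`, `dyadicWindow_eq_one`, `dyadicWindow_eq_zero`, `dyadicWindow_eq_ofReal`
  (real values `dyadicWindowRe ∈ [0,1]`), `contDiff_dyadicWindow`, `hasCompactSupport_dyadicWindow`,
  `norm_iteratedDeriv_dyadicWindow_le` (`≤ W_j H^{-j}`), `integral_norm_dyadicWindow_le` (`≤ T`),
  `le_integral_dyadicWindowRe` (`∫ w ≥ T − 2H`).
* `windowDerivConst j = W_j`, `oscDecayConst k = C_k`.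
* `norm_integral_dyadicWindow_mul_mul_cexp_le` — the decay bound displayed above;
  `norm_integral_dyadicWindow_mul_cexp_le` — the case `A = 1`;
  `norm_integral_dyadicWindow_mul_mul_le` — the trivial bound `≤ B₀ T` for `|A| ≤ B₀`.

## References

* Folklore (integration by parts against a smooth compactly supported window); cf.
  [Radziwill2012] M. Radziwiłł, *Limitations to mollifying ζ(s)*, arXiv:1207.6583, §§2–3, for the
  use of such windows, and `Literature/Analysis/Fourier/SmoothWindowKernel.lean`.
-/

noncomputable section

open Set MeasureTheory Complex Filter Finset
open scoped ContDiff FourierTransform Real Topology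

namespace Literature.Analysis.Fourier

/-! ## Iterated derivatives off the support -/

/-- If `g` vanishes on an open set then so do its iterated derivatives. [folklore] -/
theorem iteratedDeriv_eq_zero_of_eqOn_zero {g : ℝ → ℂ} {s : Set ℝ} (hs : IsOpen s)
    (h : Set.EqOn g (fun _ => (0 : ℂ)) s) (n : ℕ) {x : ℝ} (hx : x ∈ s) :
    iteratedDeriv n g x = 0 := by
  rw [h.iteratedDeriv_of_isOpen hs n hx, iteratedDeriv_const]
  split_ifs <;> rfl

/-! ## The dyadic window -/

/-- The **dyadic smooth window** `w_{T,H}(t) = f(t/H)`, `f = smoothWindow (T/H) (2T/H − 1)`: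
`w = 1` on `[T+H, 2T−H]`, `w = 0` outside `(T, 2T)`, ramps of width `H`. [folklore] -/
def dyadicWindow (T H : ℝ) (t : ℝ) : ℂ := smoothWindow (T / H) (2 * T / H - 1) (H⁻¹ * t)

/-- Unfolding lemma. [folklore] -/
theorem dyadicWindow_apply (T H t : ℝ) :
    dyadicWindow T H t = smoothWindow (T / H) (2 * T / H - 1) (H⁻¹ * t) := rfl

/-- The window as a composition with the dilation `t ↦ H⁻¹ t`. [folklore] -/
theorem dyadicWindow_eq_comp (T H : ℝ) :
    dyadicWindow T H = fun t => smoothWindow (T / H) (2 * T / H - 1) (H⁻¹ * t) := rfl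

/-- `T/H ≤ 2T/H − 1` when `0 < H`, `H ≤ T`. [folklore] -/
theorem dyadicWindow_ab {T H : ℝ} (hH : 0 < H) (hHT : H ≤ T) : T / H ≤ 2 * T / H - 1 := by
  rw [div_le_iff₀ hH, sub_mul, div_mul_cancel₀ _ hH.ne']; linarith

/-- `w = 1` on `[T + H, 2T − H]`. [folklore] -/
theorem dyadicWindow_eq_one {T H t : ℝ} (hH : 0 < H) (h1 : T + H ≤ t) (h2 : t ≤ 2 * T - H) :
    dyadicWindow T H t = 1 := by
  rw [dyadicWindow_apply]
  apply smoothWindow_eq_one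
  · rw [div_add_one hH.ne', div_le_iff₀ hH, inv_mul_eq_div, div_mul_cancel₀ _ hH.ne']; linarith
  · rw [inv_mul_eq_div, div_le_iff₀ hH, sub_mul, div_mul_cancel₀ _ hH.ne']; linarith

/-- `w = 0` for `t ≤ T` (`0 < H ≤ T`). [folklore] -/
theorem dyadicWindow_eq_zero_of_le {T H t : ℝ} (hH : 0 < H) (hHT : H ≤ T) (h : t ≤ T) :
    dyadicWindow T H t = 0 := by
  rw [dyadicWindow_apply]
  apply smoothWindow_eq_zero_of_le (dyadicWindow_ab hH hHT)
  rw [inv_mul_eq_div, div_le_div_iff_of_pos_right hH]; exact h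

/-- `w = 0` for `t ≥ 2T` (`0 < H ≤ T`). [folklore] -/
theorem dyadicWindow_eq_zero_of_ge {T H t : ℝ} (hH : 0 < H) (hHT : H ≤ T) (h : 2 * T ≤ t) :
    dyadicWindow T H t = 0 := by
  rw [dyadicWindow_apply]
  apply smoothWindow_eq_zero_of_ge (dyadicWindow_ab hH hHT)
  rw [sub_add_cancel, inv_mul_eq_div, div_le_div_iff_of_pos_right hH]; exact h

/-- `w` vanishes off `(T, 2T)`. [folklore] -/
theorem dyadicWindow_eq_zero {T H t : ℝ} (hH : 0 < H) (hHT : H ≤ T) (h : t ∉ Set.Ioo T (2 * T)) :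
    dyadicWindow T H t = 0 := by
  rw [Set.mem_Ioo, not_and_or, not_lt, not_lt] at h
  rcases h with h | h
  · exact dyadicWindow_eq_zero_of_le hH hHT h
  · exact dyadicWindow_eq_zero_of_ge hH hHT h

/-- The real value of the window: `w = ((σ(t/H − T/H) − σ(t/H − 2T/H + 1) : ℝ) : ℂ)`. [folklore] -/
def dyadicWindowRe (T H : ℝ) (t : ℝ) : ℝ :=
  Real.smoothTransition (H⁻¹ * t - T / H) - Real.smoothTransition (H⁻¹ * t - (2 * T / H - 1))

/-- `w` is real: `w = (w.re : ℂ)` with `w.re = dyadicWindowRe`. [folklore] -/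
theorem dyadicWindow_eq_ofReal (T H t : ℝ) : dyadicWindow T H t = (dyadicWindowRe T H t : ℂ) := by
  rw [dyadicWindow_apply, smoothWindow_apply, smoothStep_apply, smoothStep_apply, dyadicWindowRe]
  push_cast; ring

/-- `0 ≤ w ≤ 1` (real values), for `0 < H ≤ T`. [folklore] -/
theorem dyadicWindowRe_mem_Icc {T H : ℝ} (hH : 0 < H) (hHT : H ≤ T) (t : ℝ) :
    dyadicWindowRe T H t ∈ Set.Icc (0 : ℝ) 1 := by
  have hab := dyadicWindow_ab hH hHT
  have h1 : Real.smoothTransition (H⁻¹ * t - (2 * T / H - 1)) ≤ Real.smoothTransition (H⁻¹ * t - T / H) :=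
    Real.smoothTransition.monotone (by linarith)
  have h2 := Real.smoothTransition.le_one (H⁻¹ * t - T / H)
  have h3 := Real.smoothTransition.nonneg (H⁻¹ * t - (2 * T / H - 1))
  exact ⟨by rw [dyadicWindowRe]; linarith, by rw [dyadicWindowRe]; linarith⟩

/-- `‖w‖ ≤ 1` (`0 < H ≤ T`). [folklore] -/
theorem norm_dyadicWindow_le_one {T H : ℝ} (hH : 0 < H) (hHT : H ≤ T) (t : ℝ) :
    ‖dyadicWindow T H t‖ ≤ 1 := by
  rw [dyadicWindow_apply]; exact norm_smoothWindow_le_one (dyadicWindow_ab hH hHT) _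

/-- `w` is `C^∞`. [folklore] -/
theorem contDiff_dyadicWindow (T H : ℝ) {n : ℕ∞} : ContDiff ℝ n (dyadicWindow T H) := by
  rw [dyadicWindow_eq_comp]
  exact (contDiff_smoothWindow _ _).comp (contDiff_const.mul contDiff_id)

/-- `w` is continuous. [folklore] -/
theorem continuous_dyadicWindow (T H : ℝ) : Continuous (dyadicWindow T H) :=
  (contDiff_dyadicWindow T H (n := 0)).continuous

/-- The support of `w` lies in `[T, 2T]` (`0 < H ≤ T`). [folklore] -/
theorem support_dyadicWindow_subset {T H : ℝ} (hH : 0 < H) (hHT : H ≤ T) :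
    Function.support (dyadicWindow T H) ⊆ Set.Icc T (2 * T) := by
  intro t ht
  rw [Function.mem_support] at ht
  by_contra h
  exact ht (dyadicWindow_eq_zero hH hHT fun h' => h (Set.Ioo_subset_Icc_self h'))

/-- `w` has compact support (`0 < H ≤ T`). [folklore] -/
theorem hasCompactSupport_dyadicWindow {T H : ℝ} (hH : 0 < H) (hHT : H ≤ T) :
    HasCompactSupport (dyadicWindow T H) :=
  HasCompactSupport.of_support_subset_isCompact isCompact_Icc (support_dyadicWindow_subset hH hHT)

/-- `w` is integrable (`0 < H ≤ T`). [folklore] -/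
theorem integrable_dyadicWindow {T H : ℝ} (hH : 0 < H) (hHT : H ≤ T) :
    Integrable (dyadicWindow T H) :=
  (continuous_dyadicWindow T H).integrable_of_hasCompactSupport (hasCompactSupport_dyadicWindow hH hHT)

/-- The constants `W_0 = 1`, `W_j = 2 D_j` (`j ≥ 1`) bounding `H^j |w^{(j)}|`. [folklore] -/
def windowDerivConst (j : ℕ) : ℝ := if j = 0 then 1 else 2 * stepDerivBound j

/-- `0 ≤ W_j`. [folklore] -/
theorem windowDerivConst_nonneg (j : ℕ) : 0 ≤ windowDerivConst j := by
  unfold windowDerivConst; split_ifs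
  · norm_num
  · have := stepDerivBound_nonneg j; linarith

/-- `1 ≤ W_0` and in general `windowDerivConst 0 = 1`. [folklore] -/
theorem windowDerivConst_zero : windowDerivConst 0 = 1 := by simp [windowDerivConst]

/-- **`|w^{(j)}(t)| ≤ W_j H^{-j}`** (`0 < H ≤ T`). [folklore] -/
theorem norm_iteratedDeriv_dyadicWindow_le {T H : ℝ} (hH : 0 < H) (hHT : H ≤ T) (j : ℕ) (t : ℝ) :
    ‖iteratedDeriv j (dyadicWindow T H) t‖ ≤ windowDerivConst j / H ^ j := by
  have hcd := contDiff_infty.mp (contDiff_smoothWindow (T / H) (2 * T / H - 1) (n := ⊤)) j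
  have hcomp := congrFun (iteratedDeriv_comp_const_smul hcd H⁻¹) t
  rw [dyadicWindow_eq_comp, hcomp]
  simp only [norm_smul, norm_pow, norm_inv, Real.norm_eq_abs, abs_of_pos hH]
  rw [inv_pow, ← div_eq_inv_mul]
  apply div_le_div_of_nonneg_right _ (by positivity)
  unfold windowDerivConst
  split_ifs with hj
  · subst hj
    rw [iteratedDeriv_zero]
    exact norm_smoothWindow_le_one (dyadicWindow_ab hH hHT) _
  · refine (norm_iteratedDeriv_smoothWindow_le hj _).trans ?_
    have hD := stepDerivBound_nonneg j
    have hind : ∀ (s : Set ℝ) (y : ℝ), s.indicator (fun _ => (1 : ℝ)) y ≤ 1 := by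
      intro s y
      by_cases hy : y ∈ s
      · rw [Set.indicator_of_mem hy]
      · rw [Set.indicator_of_notMem hy]; norm_num
    have h1 := hind (Set.Icc (T / H) (T / H + 1)) (H⁻¹ * t)
    have h2 := hind (Set.Icc (2 * T / H - 1) (2 * T / H - 1 + 1)) (H⁻¹ * t)
    nlinarith

/-- `∫ |w| ≤ T` (`0 < H ≤ T`). [folklore] -/
theorem integral_norm_dyadicWindow_le {T H : ℝ} (hH : 0 < H) (hHT : H ≤ T) :
    ∫ t, ‖dyadicWindow T H t‖ ≤ T := by
  have hT : 0 ≤ T := hH.le.trans hHT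
  have hle : ∀ t, ‖dyadicWindow T H t‖ ≤ (Set.Icc T (2 * T)).indicator (fun _ => (1 : ℝ)) t := by
    intro t
    by_cases ht : t ∈ Set.Icc T (2 * T)
    · rw [Set.indicator_of_mem ht]; exact norm_dyadicWindow_le_one hH hHT t
    · rw [Set.indicator_of_notMem ht]
      have : dyadicWindow T H t = 0 := by
        by_contra h
        exact ht (support_dyadicWindow_subset hH hHT (Function.mem_support.2 h))
      rw [this, norm_zero]
  have hint : Integrable fun t => (Set.Icc T (2 * T)).indicator (fun _ => (1 : ℝ)) t :=
    (integrableOn_const (μ := volume) (s := Set.Icc T (2 * T)) (C := (1 : ℝ))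
      (by rw [Real.volume_Icc]; exact ENNReal.ofReal_ne_top)).integrable_indicator measurableSet_Icc
  calc ∫ t, ‖dyadicWindow T H t‖ ≤ ∫ t, (Set.Icc T (2 * T)).indicator (fun _ => (1 : ℝ)) t :=
        integral_mono (integrable_dyadicWindow hH hHT).norm hint hle
    _ = T := by
        rw [integral_indicator measurableSet_Icc, setIntegral_const, smul_eq_mul, mul_one,
          Real.volume_real_Icc_of_le (by linarith)]
        ring

/-- `∫ w ≥ T − 2H` (as a real number: `∫ w.re ≥ T − 2H`), for `0 < H`, `2H ≤ T`. [folklore] -/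
theorem le_integral_dyadicWindowRe {T H : ℝ} (hH : 0 < H) (hHT : 2 * H ≤ T) :
    T - 2 * H ≤ ∫ t, dyadicWindowRe T H t := by
  have hHT' : H ≤ T := by linarith
  have hcont : Continuous (dyadicWindowRe T H) := by
    unfold dyadicWindowRe; fun_prop
  have hsupp : Function.support (dyadicWindowRe T H) ⊆ Set.Icc T (2 * T) := by
    intro t ht
    apply support_dyadicWindow_subset hH hHT'
    rw [Function.mem_support] at ht ⊢
    rw [dyadicWindow_eq_ofReal]; exact_mod_cast ht
  have hint : Integrable (dyadicWindowRe T H) :=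
    hcont.integrable_of_hasCompactSupport (HasCompactSupport.of_support_subset_isCompact isCompact_Icc hsupp)
  -- compare with the indicator of `[T+H, 2T-H]`
  have hle : ∀ t, (Set.Icc (T + H) (2 * T - H)).indicator (fun _ => (1 : ℝ)) t ≤ dyadicWindowRe T H t := by
    intro t
    by_cases ht : t ∈ Set.Icc (T + H) (2 * T - H)
    · rw [Set.indicator_of_mem ht]
      have := dyadicWindow_eq_one hH ht.1 ht.2
      rw [dyadicWindow_eq_ofReal] at this
      have : dyadicWindowRe T H t = 1 := by exact_mod_cast this
      rw [this]
    · rw [Set.indicator_of_notMem ht]; exact (dyadicWindowRe_mem_Icc hH hHT' t).1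
  have hind : Integrable fun t => (Set.Icc (T + H) (2 * T - H)).indicator (fun _ => (1 : ℝ)) t :=
    (integrableOn_const (μ := volume) (s := Set.Icc (T + H) (2 * T - H)) (C := (1 : ℝ))
      (by rw [Real.volume_Icc]; exact ENNReal.ofReal_ne_top)).integrable_indicator measurableSet_Icc
  calc T - 2 * H = ∫ t, (Set.Icc (T + H) (2 * T - H)).indicator (fun _ => (1 : ℝ)) t := by
        rw [integral_indicator measurableSet_Icc, setIntegral_const, smul_eq_mul, mul_one,
          Real.volume_real_Icc_of_le (by linarith)]
        ring
    _ ≤ ∫ t, dyadicWindowRe T H t := integral_mono hind hint hle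

/-! ## The decay bound -/

/-- The constant `C_k = ∑_{j ≤ k} (k choose j) W_j` of the decay bound. [folklore] -/
def oscDecayConst (k : ℕ) : ℝ := ∑ j ∈ Finset.range (k + 1), (k.choose j : ℝ) * windowDerivConst j

/-- `1 ≤ C_k` (the term `j = 0`). [folklore] -/
theorem one_le_oscDecayConst (k : ℕ) : 1 ≤ oscDecayConst k := by
  unfold oscDecayConst
  rw [Finset.sum_range_succ']
  simp only [Nat.choose_zero_right, Nat.cast_one, windowDerivConst_zero, mul_one]
  have : 0 ≤ ∑ j ∈ Finset.range k, ((k.choose (j + 1) : ℕ) : ℝ) * windowDerivConst (j + 1) :=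
    Finset.sum_nonneg fun j _ => mul_nonneg (Nat.cast_nonneg _) (windowDerivConst_nonneg _)
  linarith

/-- `0 ≤ C_k`. [folklore] -/
theorem oscDecayConst_nonneg (k : ℕ) : 0 ≤ oscDecayConst k :=
  zero_le_one.trans (one_le_oscDecayConst k)

/-- **Leibniz bound for the windowed amplitude.** If `A` is smooth with `‖A^{(j)}(t)‖ ≤ B/T^j` on
`[T, 2T]` for `j ≤ k`, then `‖(w A)^{(k)}(t)‖ ≤ C_k B / H^k` everywhere (`1 ≤ H ≤ T`; off `(T,2T)`
the derivative vanishes). [folklore] -/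
theorem norm_iteratedDeriv_dyadicWindow_mul_le {T H : ℝ} (hH : 1 ≤ H) (hHT : H ≤ T)
    {A : ℝ → ℂ} (hA : ContDiff ℝ ∞ A) {k : ℕ} {B : ℝ} (hB : 0 ≤ B)
    (hAB : ∀ j ≤ k, ∀ t ∈ Set.Icc T (2 * T), ‖iteratedDeriv j A t‖ ≤ B / T ^ j) (t : ℝ) :
    ‖iteratedDeriv k (fun u => dyadicWindow T H u * A u) t‖ ≤ oscDecayConst k * B / H ^ k := by
  have hH0 : 0 < H := by linarith
  have hT0 : 0 < T := by linarith
  by_cases ht : t ∈ Set.Icc T (2 * T)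
  · -- Leibniz
    have hw : ContDiffAt ℝ k (dyadicWindow T H) t := (contDiff_dyadicWindow T H).contDiffAt
    have hA' : ContDiffAt ℝ k A t := (hA.of_le (by exact_mod_cast le_top)).contDiffAt
    rw [show (fun u => dyadicWindow T H u * A u) = dyadicWindow T H * A from rfl,
      iteratedDeriv_mul hw hA']
    refine (norm_sum_le _ _).trans ?_
    unfold oscDecayConst
    rw [Finset.sum_mul, Finset.sum_div]
    refine Finset.sum_le_sum fun j hj => ?_
    have hjk : j ≤ k := Nat.lt_succ_iff.1 (Finset.mem_range.1 hj)
    rw [norm_mul, norm_mul, Complex.norm_natCast]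
    have h1 := norm_iteratedDeriv_dyadicWindow_le hH0 hHT j t
    have h2 := hAB (k - j) (Nat.sub_le k j) t ht
    have hWj := windowDerivConst_nonneg j
    -- `W_j/H^j · B/T^{k-j} ≤ W_j B / H^k`
    have h3 : windowDerivConst j / H ^ j * (B / T ^ (k - j)) ≤ windowDerivConst j * B / H ^ k := by
      rw [div_mul_div_comm, div_le_div_iff₀ (by positivity) (by positivity)]
      have : H ^ k ≤ H ^ j * T ^ (k - j) := by
        calc H ^ k = H ^ j * H ^ (k - j) := by rw [← pow_add, Nat.add_sub_cancel' hjk]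
          _ ≤ H ^ j * T ^ (k - j) := by gcongr
      calc windowDerivConst j * B * H ^ k ≤ windowDerivConst j * B * (H ^ j * T ^ (k - j)) :=
            mul_le_mul_of_nonneg_left this (by positivity)
        _ = windowDerivConst j * B * (H ^ j * T ^ (k - j)) := rfl
    calc (k.choose j : ℝ) * ‖iteratedDeriv j (dyadicWindow T H) t‖ * ‖iteratedDeriv (k - j) A t‖
        ≤ (k.choose j : ℝ) * (windowDerivConst j / H ^ j) * (B / T ^ (k - j)) := by
          gcongr
      _ = (k.choose j : ℝ) * (windowDerivConst j / H ^ j * (B / T ^ (k - j))) := by ring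
      _ ≤ (k.choose j : ℝ) * (windowDerivConst j * B / H ^ k) :=
          mul_le_mul_of_nonneg_left h3 (Nat.cast_nonneg _)
      _ = (k.choose j : ℝ) * windowDerivConst j * B / H ^ k := by ring
  · -- off `[T, 2T]`: the product vanishes on the open set `[T,2T]ᶜ`
    have hopen : IsOpen (Set.Icc T (2 * T))ᶜ := isClosed_Icc.isOpen_compl
    have hzero : Set.EqOn (fun u => dyadicWindow T H u * A u) (fun _ => (0 : ℂ)) (Set.Icc T (2 * T))ᶜ := by
      intro u hu
      have : dyadicWindow T H u = 0 := by
        by_contra h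
        exact hu (support_dyadicWindow_subset hH0 hHT (Function.mem_support.2 h))
      simp [this]
    rw [iteratedDeriv_eq_zero_of_eqOn_zero hopen hzero k ht, norm_zero]
    exact div_nonneg (mul_nonneg (oscDecayConst_nonneg k) hB) (by positivity)

/-- **Decay of the windowed oscillatory integral.** For `1 ≤ H`, `H ≤ T`, a smooth amplitude `A`
with `‖A^{(j)}(t)‖ ≤ B/T^j` on `[T, 2T]` for all `j ≤ k`, and `μ ≠ 0`:
`‖∫ w_{T,H}(t) A(t) e^{iμt} dt‖ ≤ C_k B T (H|μ|)^{-k}`. [folklore] -/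
theorem norm_integral_dyadicWindow_mul_mul_cexp_le {T H : ℝ} (hH : 1 ≤ H) (hHT : H ≤ T)
    {A : ℝ → ℂ} (hA : ContDiff ℝ ∞ A) (k : ℕ) {B : ℝ} (hB : 0 ≤ B)
    (hAB : ∀ j ≤ k, ∀ t ∈ Set.Icc T (2 * T), ‖iteratedDeriv j A t‖ ≤ B / T ^ j)
    {μ : ℝ} (hμ : μ ≠ 0) :
    ‖∫ t, dyadicWindow T H t * A t * Complex.exp (I * μ * t)‖
      ≤ oscDecayConst k * B * T / (H * |μ|) ^ k := by
  have hH0 : 0 < H := by linarith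
  have hT0 : 0 < T := by linarith
  set g : ℝ → ℂ := fun u => dyadicWindow T H u * A u with hg
  have hgs : ContDiff ℝ ∞ g := (contDiff_dyadicWindow T H).mul hA
  have hgsupp : HasCompactSupport g := (hasCompactSupport_dyadicWindow hH0 hHT).mul_right
  have hint : ∀ n : ℕ, Integrable (iteratedDeriv n g) := fun n => by
    -- iterated derivatives of the compactly supported `g` are compactly supported
    -- (cf. `Literature.NumberTheory.LFunctions.GuthMaynardFourier.hasCompactSupport_iteratedDeriv`)
    have hcs : HasCompactSupport (iteratedDeriv n g) := by
      induction n with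
      | zero => simpa using hgsupp
      | succ n ih => rw [iteratedDeriv_succ]; exact ih.deriv
    exact (hgs.continuous_iteratedDeriv n (by exact_mod_cast le_top)).integrable_of_hasCompactSupport hcs
  -- the integral is a Fourier transform
  have hF : 𝓕 g (-μ / (2 * π)) = ∫ t, dyadicWindow T H t * A t * Complex.exp (I * μ * t) := by
    rw [Real.fourier_real_eq_integral_exp_smul]
    refine integral_congr_ae (Filter.Eventually.of_forall fun t => ?_)
    simp only [hg, smul_eq_mul]
    have : ((-2 * π * t * (-μ / (2 * π)) : ℝ) : ℂ) * I = I * μ * t := by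
      have hπ : (π : ℝ) ≠ 0 := Real.pi_ne_zero
      rw [show -2 * π * t * (-μ / (2 * π)) = μ * t by field_simp]
      push_cast; ring
    rw [this]; ring
  have hdec := pow_mul_norm_fourier_le hgs hint k (-μ / (2 * π))
  have habs : 2 * π * |(-μ / (2 * π))| = |μ| := by
    rw [abs_div, abs_neg, abs_of_pos (by positivity : (0 : ℝ) < 2 * π)]
    field_simp
  rw [habs, hF] at hdec
  -- bound `∫ ‖g^{(k)}‖ ≤ T · C_k B / H^k`
  have hbound : ∫ t, ‖iteratedDeriv k g t‖ ≤ T * (oscDecayConst k * B / H ^ k) := by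
    have hzero : ∀ t, t ∉ Set.Icc T (2 * T) → ‖iteratedDeriv k g t‖ = 0 := by
      intro t ht
      have hopen : IsOpen (Set.Icc T (2 * T))ᶜ := isClosed_Icc.isOpen_compl
      have hz : Set.EqOn g (fun _ => (0 : ℂ)) (Set.Icc T (2 * T))ᶜ := by
        intro u hu
        have : dyadicWindow T H u = 0 := by
          by_contra h
          exact hu (support_dyadicWindow_subset hH0 hHT (Function.mem_support.2 h))
        simp [hg, this]
      rw [iteratedDeriv_eq_zero_of_eqOn_zero hopen hz k ht, norm_zero]
    have heq : ∫ t, ‖iteratedDeriv k g t‖ = ∫ t in Set.Icc T (2 * T), ‖iteratedDeriv k g t‖ := by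
      rw [setIntegral_eq_integral_of_forall_compl_eq_zero fun t ht => hzero t ht]
    rw [heq]
    have hvol : volume.real (Set.Icc T (2 * T)) = T := by
      rw [Real.volume_real_Icc_of_le (by linarith)]; ring
    have hn := norm_setIntegral_le_of_norm_le_const (μ := volume) (s := Set.Icc T (2 * T))
      (f := fun t => ‖iteratedDeriv k g t‖) (C := oscDecayConst k * B / H ^ k)
      (by rw [Real.volume_Icc]; exact ENNReal.ofReal_lt_top)
      (fun t _ => by rw [norm_norm]; exact norm_iteratedDeriv_dyadicWindow_mul_le hH hHT hA hB hAB t)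
    rw [Real.norm_eq_abs, hvol] at hn
    calc ∫ t in Set.Icc T (2 * T), ‖iteratedDeriv k g t‖
        ≤ |∫ t in Set.Icc T (2 * T), ‖iteratedDeriv k g t‖| := le_abs_self _
      _ ≤ oscDecayConst k * B / H ^ k * T := hn
      _ = T * (oscDecayConst k * B / H ^ k) := by ring
  -- conclude
  have h1 := hdec.trans hbound
  have hHk : 0 < H ^ k := pow_pos hH0 k
  rw [mul_pow, le_div_iff₀ (by positivity : 0 < H ^ k * |μ| ^ k)]
  calc ‖∫ t, dyadicWindow T H t * A t * Complex.exp (I * μ * t)‖ * (H ^ k * |μ| ^ k)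
      = (|μ| ^ k * ‖∫ t, dyadicWindow T H t * A t * Complex.exp (I * μ * t)‖) * H ^ k := by ring
    _ ≤ T * (oscDecayConst k * B / H ^ k) * H ^ k := mul_le_mul_of_nonneg_right h1 hHk.le
    _ = oscDecayConst k * B * T := by field_simp

/-- **Decay with constant amplitude**: `‖∫ w_{T,H}(t) e^{iμt} dt‖ ≤ C_k T (H|μ|)^{-k}`
(`1 ≤ H ≤ T`, `μ ≠ 0`). [folklore] -/
theorem norm_integral_dyadicWindow_mul_cexp_le {T H : ℝ} (hH : 1 ≤ H) (hHT : H ≤ T) (k : ℕ)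
    {μ : ℝ} (hμ : μ ≠ 0) :
    ‖∫ t, dyadicWindow T H t * Complex.exp (I * μ * t)‖ ≤ oscDecayConst k * T / (H * |μ|) ^ k := by
  have h := norm_integral_dyadicWindow_mul_mul_cexp_le hH hHT (A := fun _ => (1 : ℂ)) contDiff_const k
    zero_le_one (fun j _ t ht => by
      rw [iteratedDeriv_const]
      split_ifs with hj
      · subst hj; simp
      · rw [norm_zero]; exact div_nonneg zero_le_one (pow_nonneg (by linarith) _)) hμ
  simpa using h

/-- **The trivial bound**: `‖∫ w_{T,H}(t) F(t) dt‖ ≤ B₀ T` whenever `‖F‖ ≤ B₀` on `[T, 2T]`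
(`0 < H ≤ T`; no measurability is needed, a non-integrable integrand having integral `0`).
[folklore] -/
theorem norm_integral_dyadicWindow_mul_le {T H : ℝ} (hH : 0 < H) (hHT : H ≤ T) {F : ℝ → ℂ}
    {B₀ : ℝ} (hFB : ∀ t ∈ Set.Icc T (2 * T), ‖F t‖ ≤ B₀) :
    ‖∫ t, dyadicWindow T H t * F t‖ ≤ B₀ * T := by
  have hT : 0 ≤ T := hH.le.trans hHT
  have hzero : ∀ t, t ∉ Set.Icc T (2 * T) → dyadicWindow T H t * F t = 0 := by
    intro t ht
    have : dyadicWindow T H t = 0 := by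
      by_contra h
      exact ht (support_dyadicWindow_subset hH hHT (Function.mem_support.2 h))
    simp [this]
  rw [← setIntegral_eq_integral_of_forall_compl_eq_zero fun t ht => hzero t ht]
  have hvol : volume.real (Set.Icc T (2 * T)) = T := by
    rw [Real.volume_real_Icc_of_le (by linarith)]; ring
  calc ‖∫ t in Set.Icc T (2 * T), dyadicWindow T H t * F t‖
      ≤ B₀ * volume.real (Set.Icc T (2 * T)) := by
        apply norm_setIntegral_le_of_norm_le_const (by rw [Real.volume_Icc]; exact ENNReal.ofReal_lt_top)
        intro t ht
        rw [norm_mul]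
        calc ‖dyadicWindow T H t‖ * ‖F t‖ ≤ 1 * B₀ :=
              mul_le_mul (norm_dyadicWindow_le_one hH hHT t) (hFB t ht) (norm_nonneg _) zero_le_one
          _ = B₀ := one_mul _
    _ = B₀ * T := by rw [hvol]

end Literature.Analysis.Fourier
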